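import Literature.NumberTheory.CubicFields.DavenportBoundNegSum
import Literature.NumberTheory.CubicFields.NegativeReduction
import HarnessLib

/-!
# Davenport's bound for binary cubic forms of negative discriminant

`Proofs` file (theorems only), topic `Literature/NumberTheory/CubicFields`, assembling
`NegativeReduction.lean` (Mathews reduction), `DavenportBoundNegFibers.lean`, `DavenportBoundNegPairs.lean`
and `DavenportBoundNegSum.lean`: **the number of `GL₂(ℤ)`-orbits of irreducible integral binary cubic
forms with `0 < −Disc < X` is `O(X)`** (`ncard_gl2zOrbits_neg_le`, constant `120000`; Davenport 1951 II:
`Σ_{0<−D<X} h(D) = (π²/24)X + O(X^{15/16})` — only the order of magnitude is formalized).  Every orbit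
contains a Mathews-reduced form with `a ≥ 1` and `b ≥ 0` (`exists_gl2zEquiv_negReduced_pos`: `f ∼ −f` and
`(a, b, c, d) ∼ (a, −b, c, −d)`), and those are counted by `ncard_negRed_le`.

## References

* H. Davenport, *On the class-number of binary cubic forms II*, J. London Math. Soc. 26 (1951)
  192–198, Theorem [Davenport1951CubicFormsII].
* K. Belabas, M. Bhargava, C. Pomerance, *Error estimates for the Davenport–Heilbronn theorems*,
  Duke Math. J. 153 (2010), Lemma 2.2 (`q = 1`) [BelabasBhargavaPomerance2010].
-/

noncomputable section

namespace Literature.NumberTheory.CubicFields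

namespace BinaryCubic

open Finset

/-! ### Sign normalisations inside a `GL₂(ℤ)`-orbit -/

/-- `f ∼ −f` (substitute `(u, v) ↦ (−u, −v)`). [folklore] -/
theorem gl2zEquiv_neg_smul (f : BinaryCubic ℤ) : GL2ZEquiv f ((-1 : ℤ) • f) := by
  refine ⟨-1, by rw [Matrix.det_neg, Matrix.det_one]; norm_num, ?_⟩
  refine BinaryCubic.ext ?_ ?_ ?_ ?_ <;>
    simp [twist, subst, Matrix.det_fin_two]

/-- `(a, b, c, d) ∼ (a, −b, c, −d)` (twist by `diag(−1, 1)`: `(u, v) ↦ (−u, v)` and the determinant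
sign). [folklore] -/
theorem gl2zEquiv_flip (f : BinaryCubic ℤ) : GL2ZEquiv f ⟨f.a, -f.b, f.c, -f.d⟩ := by
  refine ⟨!![-1, 0; 0, 1], by rw [Matrix.det_fin_two_of]; norm_num, ?_⟩
  refine BinaryCubic.ext ?_ ?_ ?_ ?_ <;>
    simp [twist, subst, Matrix.det_fin_two_of]

/-- **A reduced representative with `a > 0`, `b ≥ 0`.** Every irreducible integral form of negative
discriminant is `GL₂(ℤ)`-equivalent to a Mathews-reduced `(a, b, c, d)` with `a ≥ 1`, `b ≥ 0`, `d ≠ 0`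
(`exists_gl2zEquiv_negReduced`, then `f ∼ −f` and `(a,b,c,d) ∼ (a,−b,c,−d)`, which act on the witnesses
by `(θ, u, v) ↦ (θ, u, v)`, `(−θ, −u, v)`). [cite: Davenport1951CubicFormsII, §2] -/
theorem exists_gl2zEquiv_negReduced_pos (f : BinaryCubic ℤ) (hirr : f.IsIrreducible) (h : f.disc < 0) :
    ∃ g : BinaryCubic ℤ, GL2ZEquiv f g ∧ 1 ≤ g.a ∧ 0 ≤ g.b ∧ g.d ≠ 0 ∧
      ∃ θ u v : ℝ, 0 < v ∧ |u| ≤ 1 / 2 ∧ 1 ≤ u ^ 2 + v ^ 2 ∧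
      (g.b : ℝ) = -g.a * (θ + 2 * u) ∧ (g.c : ℝ) = g.a * (2 * θ * u + (u ^ 2 + v ^ 2)) ∧
      (g.d : ℝ) = -g.a * (θ * (u ^ 2 + v ^ 2)) := by
  -- irreducible forms have `a ≠ 0`, `d ≠ 0`, and this persists along equivalences
  have hd_of : ∀ g : BinaryCubic ℤ, GL2ZEquiv f g → g.a ≠ 0 ∧ g.d ≠ 0 := by
    intro g hfg
    have hgirr : g.IsIrreducible := hfg.isIrreducible_iff.mp hirr
    refine ⟨hgirr.1, ?_⟩
    have := (isIrreducible_iff_eval_ne_zero g).mp hgirr 0 1 (Or.inr one_ne_zero)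
    simpa [eval] using this
  obtain ⟨g₀, hfg₀, θ₀, u₀, v₀, hv₀, hu₀, hp₀, hb₀, hc₀, hd₀⟩ := exists_gl2zEquiv_negReduced f hirr h
  -- step 1: make `a > 0`
  obtain ⟨g₁, hfg₁, ha₁, θ₁, u₁, v₁, hv₁, hu₁, hp₁, hb₁, hc₁, hd₁⟩ : ∃ g₁ : BinaryCubic ℤ, GL2ZEquiv f g₁ ∧
      1 ≤ g₁.a ∧ ∃ θ u v : ℝ, 0 < v ∧ |u| ≤ 1 / 2 ∧ 1 ≤ u ^ 2 + v ^ 2 ∧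
      (g₁.b : ℝ) = -g₁.a * (θ + 2 * u) ∧ (g₁.c : ℝ) = g₁.a * (2 * θ * u + (u ^ 2 + v ^ 2)) ∧
      (g₁.d : ℝ) = -g₁.a * (θ * (u ^ 2 + v ^ 2)) := by
    rcases lt_or_gt_of_ne (hd_of g₀ hfg₀).1 with hneg | hpos
    · refine ⟨(-1 : ℤ) • g₀, hfg₀.trans (gl2zEquiv_neg_smul g₀), ?_, θ₀, u₀, v₀, hv₀, hu₀, hp₀, ?_, ?_, ?_⟩
      · simp only [smul_a]; omega
      · simp only [smul_a, smul_b]; push_cast; rw [hb₀]; ring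
      · simp only [smul_a, smul_c]; push_cast; rw [hc₀]; ring
      · simp only [smul_a, smul_d]; push_cast; rw [hd₀]; ring
    · exact ⟨g₀, hfg₀, hpos, θ₀, u₀, v₀, hv₀, hu₀, hp₀, hb₀, hc₀, hd₀⟩
  -- step 2: make `b ≥ 0`
  rcases le_or_gt 0 g₁.b with hb | hb
  · exact ⟨g₁, hfg₁, ha₁, hb, (hd_of g₁ hfg₁).2, θ₁, u₁, v₁, hv₁, hu₁, hp₁, hb₁, hc₁, hd₁⟩
  · have hfg₂ := hfg₁.trans (gl2zEquiv_flip g₁)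
    refine ⟨⟨g₁.a, -g₁.b, g₁.c, -g₁.d⟩, hfg₂, ha₁, by simp only; omega, (hd_of _ hfg₂).2,
      -θ₁, -u₁, v₁, hv₁, by rw [abs_neg]; exact hu₁, by rw [neg_sq]; exact hp₁, ?_, ?_, ?_⟩
    · simp only; push_cast; rw [hb₁]; ring
    · simp only; rw [hc₁, neg_sq]; ring
    · simp only; push_cast; rw [hd₁, neg_sq]; ring

/-! ### The bound for negative discriminants -/

/-- **Davenport's bound, negative discriminant (order of magnitude).** The number of `GL₂(ℤ)`-orbits
of irreducible integral binary cubic forms `f` with `0 < −Disc f < X` is at most `120000·X`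
(H. Davenport 1951 II: `Σ_{0<−D<X} h(D) = (π²/24)X + O(X^{15/16})`; only the order of magnitude is
formalised).  Every orbit contains a Mathews-reduced form with `a ≥ 1`, `b ≥ 0`
(`exists_gl2zEquiv_negReduced_pos`), and those are counted by `ncard_negRed_le`.
[cite: Davenport1951CubicFormsII, Theorem] -/
theorem ncard_gl2zOrbits_neg_le (X : ℕ) :
    (({O : Set (BinaryCubic ℤ) | ∃ f : BinaryCubic ℤ, O = gl2zOrbit f ∧ f.IsIrreducible ∧
        0 < -f.disc ∧ -f.disc < X}.ncard : ℕ) : ℝ) ≤ 120000 * X := by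
  classical
  rcases Nat.eq_zero_or_pos X with hX0 | hXpos
  · subst hX0
    have : {O : Set (BinaryCubic ℤ) | ∃ f : BinaryCubic ℤ, O = gl2zOrbit f ∧ f.IsIrreducible ∧
        0 < -f.disc ∧ -f.disc < ((0 : ℕ) : ℤ)} = ∅ := by
      ext O
      simp only [Set.mem_setOf_eq, Set.mem_empty_iff_false, iff_false, not_exists, not_and]
      intro f _ _ h1 h2
      push_cast at h2
      omega
    rw [this, Set.ncard_empty]; simp
  have hX1 : (1 : ℝ) ≤ X := by exact_mod_cast hXpos
  set ξ : ℝ := (X : ℝ) ^ ((12 : ℕ) : ℝ)⁻¹ with hξdef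
  have hξ12 : ξ ^ 12 = X := Real.rpow_inv_natCast_pow (by positivity) (by norm_num)
  have hξ1 : 1 ≤ ξ := Real.one_le_rpow hX1 (by positivity)
  set Rq : Set (ℤ × (ℤ × (ℤ × ℤ))) := {z | 1 ≤ z.1 ∧ 0 ≤ z.2.1 ∧ z.2.2.1 ≠ 0 ∧ ∃ θ u v : ℝ, 0 < v ∧
        |u| ≤ 1 / 2 ∧ 1 ≤ u ^ 2 + v ^ 2 ∧ (z.2.1 : ℝ) = -z.1 * (θ + 2 * u) ∧
        (z.2.2.2 : ℝ) = z.1 * (2 * θ * u + (u ^ 2 + v ^ 2)) ∧ (z.2.2.1 : ℝ) = -z.1 * (θ * (u ^ 2 + v ^ 2)) ∧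
        4 * (z.1 : ℝ) ^ 4 * ((θ - u) ^ 2 + v ^ 2) ^ 2 * v ^ 2 < (X : ℝ)} with hRq
  have hcount := ncard_negRed_le hξ1 hξ12
  -- orbits inject into the image of `Rq`
  have horb : {O : Set (BinaryCubic ℤ) | ∃ f : BinaryCubic ℤ, O = gl2zOrbit f ∧ f.IsIrreducible ∧
        0 < -f.disc ∧ -f.disc < X} ⊆
      (fun z : ℤ × (ℤ × (ℤ × ℤ)) => gl2zOrbit (BinaryCubic.mk z.1 z.2.1 z.2.2.2 z.2.2.1)) '' Rq := by
    rintro O ⟨f, rfl, hirr, hD, hDX⟩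
    obtain ⟨g, hfg, ha, hb, hd, θ, u, v, hv, hu, hp, hb', hc', hd'⟩ :=
      exists_gl2zEquiv_negReduced_pos f hirr (by linarith)
    have hgD : g.disc = f.disc := hfg.disc_eq
    have hnegD := neg_disc_eq_of_witness hb' hc' hd'
    refine ⟨(g.a, (g.b, (g.d, g.c))), ⟨ha, hb, hd, θ, u, v, hv, hu, hp, hb', hc', hd', ?_⟩, ?_⟩
    · simp only
      rw [← hnegD, hgD]
      have : ((f.disc : ℤ) : ℝ) > -(X : ℝ) := by
        have h2 : -f.disc < (X : ℤ) := hDX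
        have : ((-f.disc : ℤ) : ℝ) < ((X : ℤ) : ℝ) := by exact_mod_cast h2
        push_cast at this; linarith
      linarith
    · simp only
      have : (BinaryCubic.mk g.a g.b g.c g.d) = g := rfl
      rw [this]
      exact (gl2zOrbit_eq_iff.mpr hfg).symm
  -- finiteness of `Rq` via the `a`-fibres
  set Na : ℕ := ⌊ξ ^ 3⌋₊ with hNadef
  have hξ0 : 0 < ξ := by linarith
  have hmemA : ∀ z ∈ Rq, z.1 ∈ Finset.Icc (1 : ℤ) Na := by
    rintro ⟨a, b, d, c⟩ ⟨ha, hb0, hd0, θ, u, v, hv, hu, hp, hb', hc', hd', hX'⟩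
    simp only at ha hb' hX'
    have haR : (1 : ℝ) ≤ a := by exact_mod_cast ha
    have ha' : (a : ℝ) < ξ ^ 3 := (b_lt_of_witness haR hu hp hX' hξ0 hξ12).2
    have haNa : a ≤ (Na : ℤ) := by
      have h1 : a.toNat ≤ Na := by
        rw [hNadef]; apply Nat.le_floor
        have : ((a.toNat : ℕ) : ℝ) = ((a : ℤ) : ℝ) := by exact_mod_cast Int.toNat_of_nonneg (by omega)
        rw [this]; exact ha'.le
      omega
    exact Finset.mem_Icc.mpr ⟨ha, haNa⟩
  have hfibfin : ∀ a ∈ Finset.Icc (1 : ℤ) Na, ({t : ℤ × (ℤ × ℤ) | (a, t) ∈ Rq}).Finite := by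
    intro a ha
    have ha1 : 1 ≤ a := (Finset.mem_Icc.mp ha).1
    set α : ℝ := ((a.toNat : ℕ) : ℝ) ^ ((3 : ℕ) : ℝ)⁻¹ with hαdef
    have hα1 : 1 ≤ α := Real.one_le_rpow (by exact_mod_cast (show 1 ≤ a.toNat by omega)) (by positivity)
    have hαa : α ^ 3 = a := by
      rw [hαdef, Real.rpow_inv_natCast_pow (by positivity) (by norm_num)]
      exact_mod_cast Int.toNat_of_nonneg (by omega)
    refine (aFibre_neg_finite a ha1 hξ1 hξ12 hα1 hαa).subset ?_
    rintro t ⟨-, ht⟩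
    exact ht
  have hRqfin : Rq.Finite := by
    refine (((Finset.Icc (1 : ℤ) Na).finite_toSet).biUnion fun a ha =>
      ((hfibfin a ha).image (Prod.mk a))).subset ?_
    intro z hz
    rw [Set.mem_iUnion₂]
    exact ⟨z.1, hmemA z hz, ⟨z.2, hz, rfl⟩⟩
  calc (({O : Set (BinaryCubic ℤ) | ∃ f : BinaryCubic ℤ, O = gl2zOrbit f ∧ f.IsIrreducible ∧
        0 < -f.disc ∧ -f.disc < X}.ncard : ℕ) : ℝ)
      ≤ (((fun z : ℤ × (ℤ × (ℤ × ℤ)) => gl2zOrbit (BinaryCubic.mk z.1 z.2.1 z.2.2.2 z.2.2.1)) '' Rq).ncard : ℝ) := by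
        exact_mod_cast Set.ncard_le_ncard horb (hRqfin.image _)
    _ ≤ (Rq.ncard : ℝ) := by exact_mod_cast Set.ncard_image_le hRqfin
    _ ≤ 118208 * ξ ^ 12 := hcount
    _ ≤ 120000 * X := by rw [hξ12]; nlinarith

end BinaryCubic

end Literature.NumberTheory.CubicFields

end
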